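import Mathlib
import Summits.Ventures.HodgeRepro.Tier4.Line1.RTFSetting
import Summits.Ventures.HodgeRepro.Tier4.Line1.HeckeIsolation
import Summits.Ventures.HodgeRepro.Tier4.Line1.HeckeIsolationHecke
import Summits.Ventures.HodgeRepro.Tier4.Line1.HeckeBlockIdempotent
import Summits.Ventures.HodgeRepro.Tier4.Line1.HeckeIsolationSpherical
import Summits.Ventures.HodgeRepro.Tier4.Line1.HeckeIsolationIdempotent
import Summits.Ventures.HodgeRepro.Tier4.Line1.IsotypicIdempotent
import Summits.Ventures.HodgeRepro.Tier4.Line1.IsotypicBlock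
import Summits.Ventures.HodgeRepro.Tier4.Line1.IsotypicInstance
import Summits.Ventures.HodgeRepro.Tier4.Line1.IsotypicHeckeAlgebra
import Summits.Ventures.HodgeRepro.Tier4.Line1.IsotypicBernsteinIso

/-!
# Tier4/Line1/IsotypicIdempotentData — (C-PLUG): THE COMPLETE type-σ `IdempotentData` over the kernel Hecke algebra
`H_σ`, from the block decomposition (C-PROJ), the non-zero vector (C-NZ) and multiplicity one of the cores (C2)

Blind re-derivation cell `pub-hodge-repro`, Tier 4 (README §9–§10), seat t4-L1-p5 (prover, LINE L1, gen 3; plan-1's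
cut (C-PLUG) S14342, taken S14344).  Target tree path `lean/Summits/Ventures/HodgeRepro/Tier4/Line1/IsotypicIdempotentData.lean`.
Consumes by name: t4-L1-p3 g3's `IsotypicHeckeAlgebra` (p692571: `HeckeAlg S K ρ …` with its `Ring` / `Algebra ℂ` /
`Module` / `IsScalarTower` instances, `hact_heckeAlg` (rfl), `hfull_heckeAlg`, `isSimpleModule_isotypic` = (C1)),
`IsotypicInstance` (p691179: `IdempotentData.ofIsotypic`, `isotypicFixed`), t4-L1-p2 g4's `IsotypicBernsteinIso`
(p691785: `hnon_of_multiplicityOne_core` = (C2) from multiplicity one of the cores), this seat's `HeckeBlockIdempotent`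
(p689660) and `HeckeIsolationIdempotent` (p691579).

WHAT THIS IS.  `IdempotentData.ofIsotypic` (p3) displays, beyond the kernel facts, the Hecke elements (`tst`, `htst`,
`htst_conv`, `hact`), the constituents `W` / projections `π` and (C1) / (C2).  Here every one of them is DISCHARGED
by name from three inputs that are cuts in flight (S14342):
* `H := HeckeAlg S K ρ …` (p3), `tst := Subtype.val` — `htst`, `htst_conv` are the carrier, `hact` is `rfl`;
* (C-PROJ) the DECOMPOSITION of the fixed block `Vb = isotypicFixed` along the constituents: a finite set `s` of
  indices and projectors `P m` with the nine clauses of S14342 (`isotypicConstituent`, `isotypicProj`: the `W i`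
  and the `H`-linear `π i`, `hπmem`/`hπsum`/`hπid`/`hπzero` from the clauses; `H`-linearity of `π i` from the
  commutation clause 8 with `R(tst r)`);
* (C-NZ) a non-zero vector of `Vb ∩ τ m` (gives `m ∈ s` by clause 9 and the index `i₀`);
* (C1) `isSimpleModule_isotypic` with clause 10 (every `i ∈ s` has a non-zero vector); (C2) `hnon_of_multiplicityOne_core`
  under the DISPLAYED multiplicity one of the cores `hM`.
`IdempotentData.ofIsotypicDecomposition` is the complete instance; `isolationRealised_isotypic` composes it with
`isolationRealised_of_idempotentData`: (S3″) for the corner forms' type σ is a kernel theorem modulo (C-PROJ), (C-NZ)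
(theorems on landing), `hM` (multiplicity one of the cores, DATA/print), the two test-vector clauses and the dictionary
`RealisedHecke`.  Nothing of these is proved here.  Nothing here says anything about the status of the Hodge conjecture
for CM abelian varieties, which is NOT proved (HC_CM is NOT proved by anyone in this repository).
-/

set_option autoImplicit false

noncomputable section

namespace Summit.Ventures.HodgeRepro.Tier4.Line1

open MeasureTheory Topology NumberField Common PeriodCloser

namespace RTF.Setting

variable {G : Type} [Group G] [TopologicalSpace G] [IsTopologicalGroup G] [MeasurableSpace G] [BorelSpace G]
  (S : Setting G) (K : Subgroup G) {d : ℕ} (ρ : K →* Matrix (Fin d) (Fin d) ℂ)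
  (hKo : IsOpen (K : Set G)) (hKc : IsCompact (K : Set G)) (hρ : Continuous ρ) (hirr : IsIrreducibleRep ρ)
  [SecondCountableTopology G] [T2Space G] [MeasurableMul G] [SFinite S.μ]
  (τ : ℕ → Set (G → ℂ))

section Constituents

/-- **the constituent `τ i ∩ Vb` of the type-σ block as an `H_σ`-submodule** (for an index set `s`). -/
def isotypicConstituent (hinv : ∀ m', S.IsInvariantSubspace (τ m')) (s : Finset ℕ)
    (hs : ∀ m ∈ s, ∃ ψ ∈ isotypicFixed S K ρ hKo hKc hρ, ψ ∈ τ m ∧ ψ ≠ 0) (i : ↥s) :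
    Submodule (HeckeAlg S K ρ hKo hKc hρ hirr) (isotypicFixed S K ρ hKo hKc hρ) where
  carrier := {ψ | (ψ : G → ℂ) ∈ τ i}
  add_mem' := by
    intro a b ha hb
    have h := (hinv i).add a ha b hb
    exact h
  zero_mem' := by
    obtain ⟨ψ, _, hψτ, _⟩ := hs i i.2
    have h := (hinv i).smul ψ hψτ 0
    have h0 : (fun x => (0 : ℂ) * ψ x) = (0 : G → ℂ) := by
      funext x
      simp
    rw [h0] at h
    exact h
  smul_mem' := by
    intro t a ha
    show ((t • a : isotypicFixed S K ρ hKo hKc hρ) : G → ℂ) ∈ τ i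
    rw [hact_heckeAlg S K ρ hKo hKc hρ hirr]
    exact (hinv i).conv a ha _ t.2.1

/-- membership in a constituent. -/
theorem mem_isotypicConstituent (hinv : ∀ m', S.IsInvariantSubspace (τ m')) (s : Finset ℕ)
    (hs : ∀ m ∈ s, ∃ ψ ∈ isotypicFixed S K ρ hKo hKc hρ, ψ ∈ τ m ∧ ψ ≠ 0) (i : ↥s)
    (ψ : isotypicFixed S K ρ hKo hKc hρ) :
    ψ ∈ isotypicConstituent S K ρ hKo hKc hρ hirr τ hinv s hs i ↔ (ψ : G → ℂ) ∈ τ i := Iff.rfl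

/-- **the projector of the decomposition as an `H_σ`-linear map of the block**: from `P m` with the additivity,
homogeneity and commutation clauses (C-PROJ). -/
def isotypicProj (P : ℕ → (G → ℂ) → (G → ℂ))
    (h1 : ∀ m, ∀ ψ ∈ isotypicFixed S K ρ hKo hKc hρ, P m ψ ∈ isotypicFixed S K ρ hKo hKc hρ)
    (h3 : ∀ m, ∀ ψ ∈ isotypicFixed S K ρ hKo hKc hρ, ∀ ψ' ∈ isotypicFixed S K ρ hKo hKc hρ,
      P m (ψ + ψ') = P m ψ + P m ψ')
    (h8 : ∀ m, ∀ f, IsTest f → ∀ ψ ∈ isotypicFixed S K ρ hKo hKc hρ,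
      S.R f ψ ∈ isotypicFixed S K ρ hKo hKc hρ → P m (S.R f ψ) = S.R f (P m ψ))
    (m : ℕ) : isotypicFixed S K ρ hKo hKc hρ →ₗ[HeckeAlg S K ρ hKo hKc hρ hirr] isotypicFixed S K ρ hKo hKc hρ where
  toFun ψ := ⟨P m ψ, h1 m ψ ψ.2⟩
  map_add' ψ ψ' := Subtype.ext (by
    simp only [Submodule.coe_add]
    exact h3 m ψ ψ.2 ψ' ψ'.2)
  map_smul' t ψ := Subtype.ext (by
    simp only [RingHom.id_apply]
    rw [hact_heckeAlg S K ρ hKo hKc hρ hirr, hact_heckeAlg S K ρ hKo hKc hρ hirr]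
    exact h8 m (t : G → ℂ) t.2.1 ψ ψ.2 (S.R_mem_isotypicFixed K ρ hKo hKc hρ hirr t.2 ψ.2))

/-- the projector, applied. -/
theorem isotypicProj_apply (P : ℕ → (G → ℂ) → (G → ℂ))
    (h1 : ∀ m, ∀ ψ ∈ isotypicFixed S K ρ hKo hKc hρ, P m ψ ∈ isotypicFixed S K ρ hKo hKc hρ)
    (h3 : ∀ m, ∀ ψ ∈ isotypicFixed S K ρ hKo hKc hρ, ∀ ψ' ∈ isotypicFixed S K ρ hKo hKc hρ,
      P m (ψ + ψ') = P m ψ + P m ψ')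
    (h8 : ∀ m, ∀ f, IsTest f → ∀ ψ ∈ isotypicFixed S K ρ hKo hKc hρ,
      S.R f ψ ∈ isotypicFixed S K ρ hKo hKc hρ → P m (S.R f ψ) = S.R f (P m ψ))
    (m : ℕ) (ψ : isotypicFixed S K ρ hKo hKc hρ) :
    ((isotypicProj S K ρ hKo hKc hρ hirr P h1 h3 h8 m ψ : isotypicFixed S K ρ hKo hKc hρ) : G → ℂ) = P m ψ := rfl

end Constituents

section Plug

variable (hu : IsUnitaryRep ρ) [Countable S.Gk] [LocallyCompactSpace G]

/-- **(C-PLUG) — THE COMPLETE type-σ `IdempotentData` over `H_σ`**, from: the decomposition of the fixed block along the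
constituents (C-PROJ: `s`, `P` and the nine clauses, plus clause 10 «every `m ∈ s` carries a non-zero block vector»),
a non-zero vector of `Vb ∩ τ m` (C-NZ: `hne`), multiplicity one of the cores (`hM`, DISPLAYED).  `H := HeckeAlg`,
`tst := Subtype.val` (`htst`, `htst_conv` by the carrier, `hact` by `rfl`), `W i := τ i ∩ Vb`, `π i` from `P i`;
(C1) by p3's `isSimpleModule_isotypic`, (C2) by p2's `hnon_of_multiplicityOne_core`. -/
def IdempotentData.ofIsotypicDecomposition (hinv : ∀ m', S.IsInvariantSubspace (τ m'))
    (hirr' : ∀ m', S.IsIrreducible (τ m')) (m : ℕ) (s : Finset ℕ) (P : ℕ → (G → ℂ) → (G → ℂ))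
    (h1 : ∀ m, ∀ ψ ∈ isotypicFixed S K ρ hKo hKc hρ, P m ψ ∈ isotypicFixed S K ρ hKo hKc hρ)
    (h2 : ∀ m ∈ s, ∀ ψ ∈ isotypicFixed S K ρ hKo hKc hρ, P m ψ ∈ τ m)
    (h3 : ∀ m, ∀ ψ ∈ isotypicFixed S K ρ hKo hKc hρ, ∀ ψ' ∈ isotypicFixed S K ρ hKo hKc hρ,
      P m (ψ + ψ') = P m ψ + P m ψ')
    (h5 : ∀ ψ ∈ isotypicFixed S K ρ hKo hKc hρ, ∑ m ∈ s, P m ψ = ψ)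
    (h6 : ∀ m, ∀ ψ ∈ isotypicFixed S K ρ hKo hKc hρ, ψ ∈ τ m → P m ψ = ψ)
    (h7 : ∀ m m', m ≠ m' → ∀ ψ ∈ isotypicFixed S K ρ hKo hKc hρ, ψ ∈ τ m' → P m ψ = 0)
    (h8 : ∀ m, ∀ f, IsTest f → ∀ ψ ∈ isotypicFixed S K ρ hKo hKc hρ,
      S.R f ψ ∈ isotypicFixed S K ρ hKo hKc hρ → P m (S.R f ψ) = S.R f (P m ψ))
    (h9 : ∀ m, (∃ ψ ∈ isotypicFixed S K ρ hKo hKc hρ, ψ ∈ τ m ∧ ψ ≠ 0) → m ∈ s)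
    (h10 : ∀ m ∈ s, ∃ ψ ∈ isotypicFixed S K ρ hKo hKc hρ, ψ ∈ τ m ∧ ψ ≠ 0)
    (hne : ∃ ψ ∈ isotypicFixed S K ρ hKo hKc hρ, ψ ∈ τ m ∧ ψ ≠ 0)
    (hM : ∀ i j : ↥s, i ≠ j →
      ¬ S.IsoRep (S.core (isotypicConstituent S K ρ hKo hKc hρ hirr τ hinv s h10 i))
        (S.core (isotypicConstituent S K ρ hKo hKc hρ hirr τ hinv s h10 j))) :
    haveI := finiteDimensional_isotypicFixed S K ρ hKo hKc hρ hu
    IdempotentData S τ m (HeckeAlg S K ρ hKo hKc hρ hirr) (↥s) (isotypicFixed S K ρ hKo hKc hρ) :=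
  haveI := finiteDimensional_isotypicFixed S K ρ hKo hKc hρ hu
  let W := isotypicConstituent S K ρ hKo hKc hρ hirr τ hinv s h10
  let π := isotypicProj S K ρ hKo hKc hρ hirr P h1 h3 h8
  haveI hsimple : ∀ i : ↥s, IsSimpleModule (HeckeAlg S K ρ hKo hKc hρ hirr) (W i) := fun i => by
    obtain ⟨ψ, hψV, hψτ, hψne⟩ := h10 i i.2
    exact S.isSimpleModule_isotypic K ρ hKo hKc hρ hirr hu i (hinv i) (hirr' i) (W i)
      (mem_isotypicConstituent S K ρ hKo hKc hρ hirr τ hinv s h10 i)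
      ⟨⟨ψ, hψV⟩, hψτ, fun h => hψne (congrArg Subtype.val h)⟩
  IdempotentData.ofIsotypic S K ρ hKo hKc hρ hu hirr τ m (HeckeAlg S K ρ hKo hKc hρ hirr) (↥s)
    (fun t => (t : G → ℂ)) (fun t => t.2.1) (fun t => t.2.2.2) (hact_heckeAlg S K ρ hKo hKc hρ hirr)
    (fun i => (i : ℕ)) ⟨m, h9 m hne⟩ rfl W (mem_isotypicConstituent S K ρ hKo hKc hρ hirr τ hinv s h10)
    (fun i => π (i : ℕ)) (fun i v => h2 i i.2 v v.2)
    (fun v => Subtype.ext (by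
      simp only [Submodule.coe_sum]
      rw [Finset.sum_coe_sort s (fun i => ((π i v : isotypicFixed S K ρ hKo hKc hρ) : G → ℂ))]
      exact h5 v v.2))
    (fun i w hw => Subtype.ext (h6 i w w.2 hw))
    (fun i j hij w hw => Subtype.ext (h7 i j (fun h => hij (Subtype.ext h)) w w.2 hw))
    (S.hnon_of_multiplicityOne_core (isTest_eσ S K ρ hKo hKc hρ) (mem_isotypicFixed S K ρ hKo hKc hρ)
      (hact_heckeAlg S K ρ hKo hKc hρ hirr) (fun _ hf => S.hfull_heckeAlg K ρ hKo hKc hρ hirr hf) hinv hirr'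
      (mem_isotypicConstituent S K ρ hKo hKc hρ hirr τ hinv s h10) hM)

end Plug

end RTF.Setting

section Assembly

variable {Form : Type} [AddCommGroup Form] [Module ℂ Form] {A : FormAlgebra Form} {W : Witness A}
  {G : Type} [Group G] [TopologicalSpace G] [IsTopologicalGroup G] [MeasurableSpace G] [BorelSpace G]
  (S : RTF.Setting G) (χ : S.T → ℂ) (χ' : S.T' → ℂ) (τ : ℕ → Set (G → ℂ)) (Lift : ℕ → Prop)
  (φ : ℕ → G → ℂ) (n : ℕ → ℕ) (tf : W.Translates → (G → ℂ) × (G → ℂ))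
  (K : Subgroup G) {d : ℕ} (ρ : K →* Matrix (Fin d) (Fin d) ℂ)
  (hKo : IsOpen (K : Set G)) (hKc : IsCompact (K : Set G)) (hρ : Continuous ρ)
  (hirr : RTF.Setting.IsIrreducibleRep ρ)

/-- **(S3″) FOR THE CORNER FORMS' TYPE σ, END TO END**: `IsolationRealised` from the type-σ block with its kernel Hecke
algebra `H_σ`, the decomposition (C-PROJ) of the block, non-zero block vectors at the constituents carrying both
periods (C-NZ), multiplicity one of the cores (`hM`, DISPLAYED), the test-vector clauses and the dictionary
`RealisedHecke` for the Hecke elements of `H_σ`.  `Lift` is not used. -/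
theorem isolationRealised_isotypic [Countable S.Gk] [MeasurableMul G] [SecondCountableTopology G] [T2Space G]
    [SFinite S.μ] [LocallyCompactSpace G] (hu : RTF.Setting.IsUnitaryRep ρ) (hB : S.IsAdaptedONB τ φ n)
    (s : Finset ℕ) (P : ℕ → (G → ℂ) → (G → ℂ))
    (h1 : ∀ m, ∀ ψ ∈ RTF.Setting.isotypicFixed S K ρ hKo hKc hρ, P m ψ ∈ RTF.Setting.isotypicFixed S K ρ hKo hKc hρ)
    (h2 : ∀ m ∈ s, ∀ ψ ∈ RTF.Setting.isotypicFixed S K ρ hKo hKc hρ, P m ψ ∈ τ m)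
    (h3 : ∀ m, ∀ ψ ∈ RTF.Setting.isotypicFixed S K ρ hKo hKc hρ, ∀ ψ' ∈ RTF.Setting.isotypicFixed S K ρ hKo hKc hρ,
      P m (ψ + ψ') = P m ψ + P m ψ')
    (h5 : ∀ ψ ∈ RTF.Setting.isotypicFixed S K ρ hKo hKc hρ, ∑ m ∈ s, P m ψ = ψ)
    (h6 : ∀ m, ∀ ψ ∈ RTF.Setting.isotypicFixed S K ρ hKo hKc hρ, ψ ∈ τ m → P m ψ = ψ)
    (h7 : ∀ m m', m ≠ m' → ∀ ψ ∈ RTF.Setting.isotypicFixed S K ρ hKo hKc hρ, ψ ∈ τ m' → P m ψ = 0)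
    (h8 : ∀ m, ∀ f, RTF.IsTest f → ∀ ψ ∈ RTF.Setting.isotypicFixed S K ρ hKo hKc hρ,
      S.R f ψ ∈ RTF.Setting.isotypicFixed S K ρ hKo hKc hρ → P m (S.R f ψ) = S.R f (P m ψ))
    (h9 : ∀ m, (∃ ψ ∈ RTF.Setting.isotypicFixed S K ρ hKo hKc hρ, ψ ∈ τ m ∧ ψ ≠ 0) → m ∈ s)
    (h10 : ∀ m ∈ s, ∃ ψ ∈ RTF.Setting.isotypicFixed S K ρ hKo hKc hρ, ψ ∈ τ m ∧ ψ ≠ 0)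
    (hne : ∀ m, S.PeriodNonzeroT χ (τ m) → S.PeriodNonzeroT' χ' (τ m) →
      ∃ ψ ∈ RTF.Setting.isotypicFixed S K ρ hKo hKc hρ, ψ ∈ τ m ∧ ψ ≠ 0)
    (hM : ∀ i j : ↥s, i ≠ j →
      ¬ S.IsoRep (S.core (RTF.Setting.isotypicConstituent S K ρ hKo hKc hρ hirr τ hB.inv s h10 i))
        (S.core (RTF.Setting.isotypicConstituent S K ρ hKo hKc hρ hirr τ hB.inv s h10 j)))
    (hPA : ∀ m, S.PeriodNonzeroT χ (τ m) →
      ∃ w ∈ RTF.Setting.blockAdmissible τ m (RTF.Setting.isotypicFixed S K ρ hKo hKc hρ),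
        S.periodT χ (fun t => w t) ≠ 0)
    (hPA' : ∀ m, S.PeriodNonzeroT' χ' (τ m) →
      ∃ w' ∈ RTF.Setting.blockAdmissible τ m (RTF.Setting.isotypicFixed S K ρ hKo hKc hρ),
        S.periodT' χ' (fun t' => w' t') ≠ 0)
    (hreal : RealisedHecke S χ χ' φ n tf (RTF.Setting.HeckeAlg S K ρ hKo hKc hρ hirr) (fun t => (t : G → ℂ))) :
    IsolationRealised S χ χ' τ Lift φ n tf := by
  haveI := RTF.Setting.finiteDimensional_isotypicFixed S K ρ hKo hKc hρ hu
  exact isolationRealised_of_idempotentData S χ χ' τ Lift φ n tf (RTF.Setting.HeckeAlg S K ρ hKo hKc hρ hirr)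
    (fun t => (t : G → ℂ)) hB (fun _ => ↥s) (fun _ => RTF.Setting.isotypicFixed S K ρ hKo hKc hρ)
    (fun m hT hT' => RTF.Setting.IdempotentData.ofIsotypicDecomposition S K ρ hKo hKc hρ hirr τ hu hB.inv hB.irred m s
      P h1 h2 h3 h5 h6 h7 h8 h9 h10 (hne m hT hT') hM)
    (fun _ _ _ => rfl) hPA hPA' hreal

end Assembly

end Summit.Ventures.HodgeRepro.Tier4.Line1

end
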